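import Mathlib
import Summits.Ventures.PercRepro.TriangleCapBroomLocus

/-!
# PercRepro — THE SECOND-BEST LOCUS ON THE BIPARTITE CLASS AT `r ≥ 3`, AND OF THE ROW `a = 3`: an `a`-bipartite
graph with `r ≥ 3` missing pairs at `closed − 2 (r − 2)` is `K_{a,k−a}` minus a broom, or at `r = 4` minus a
`4`-cycle; on the row `a = 3` (`k ≥ r + 7`) every second-best graph is of that shape (p3, gen 45; part 204c)

`bipSub_second_best_locus`: the identity of part 185 (`sum_deg_sq_bipSub`) turns `Σ d² + r (k − 1 − r) + 2 (r − 2)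
= m k` into `Σ_H d² + 2 (r − 2) = r (r + 1)` for the missing graph `H`, and part 204b decides `H`.
`three_row_second_best_locus`: a second-best graph of the cell `(k, 3, r)`, `r ≥ 3`, is `3`-bipartite (part 190's
non-bipartite gap `2 (k − 7)` exceeds `2 (r − 2)` for `k ≥ r + 7`) with a non-star missing graph (a star is
extremal), hence a broom or a `4`-cycle. With parts 200 and 202 the second-best locus of the row `a = 3` is now
known at every `r`: `B2` (`k ≥ 10`) at `r = 0`, the hung `K_{3,k−4}` at `r = 1`, the `2`-matchings at `r = 2`,
the brooms (and the `4`-cycles at `r = 4`) for `r ≥ 3`. Axioms: standard.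
-/

namespace PercRepro

namespace TriangleCap

namespace C047

open Finset

variable {V : Type*} [Fintype V] [DecidableEq V]

/-- **THE SECOND-BEST LOCUS ON THE BIPARTITE CLASS, `r ≥ 3`:** `BipSub D A`, `|A| = a`, `m + r = a (k − a)`,
`3 ≤ r`, `r + 1 ≤ k`, the missing pairs not a star, `Σ_v d(v)² + r (k − 1 − r) + 2 (r − 2) = m k` ⇒ the missing
graph is a broom or (`r = 4`) a `4`-cycle. -/
theorem bipSub_second_best_locus (D : SimpleGraph V) [DecidableRel D.Adj] (A : Finset V) (hD : BipSub D A)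
    (a r : ℕ) (hA : A.card = a) (hm : D.edgeFinset.card + r = a * (Fintype.card V - a))
    (hr : r + 1 ≤ Fintype.card V) (hr3 : 3 ≤ r) (hns : ¬ ∃ v, MissingStar D A v)
    (heq : ∑ v, deg D v * deg D v + r * (Fintype.card V - 1 - r) + 2 * (r - 2) =
      D.edgeFinset.card * Fintype.card V) :
    IsBroom (missingGraph D A) ∨ (r = 4 ∧ IsC4 (missingGraph D A)) := by
  have key := sum_deg_sq_bipSub D A hD
  have hM := card_edges_missingGraph D A hD a r hA hm
  rw [hM, hA] at key
  have hfree := cliqueFree_of_bipSub (missingGraph D A) A (bipSub_missingGraph D A)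
  have hns' : ∀ v, ∃ e ∈ (missingGraph D A).edgeFinset, v ∉ e := by
    intro v
    by_contra hcon
    push Not at hcon
    apply hns
    refine ⟨v, fun x y hx hy hxy => ?_⟩
    have he : s(x, y) ∈ (missingGraph D A).edgeFinset := by
      rw [SimpleGraph.mem_edgeFinset, SimpleGraph.mem_edgeSet, missingGraph_adj]
      exact ⟨by tauto, hxy⟩
    have := hcon _ he
    rw [Sym2.mem_iff] at this
    rcases this with h | h
    · exact Or.inl h.symm
    · exact Or.inr h.symm
  -- the missing graph's `Σ d² + 2 (r − 2) = r (r + 1)`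
  have hHeq : ∑ v, deg (missingGraph D A) v * deg (missingGraph D A) v + 2 * (r - 2) = r * (r + 1) := by
    obtain ⟨t, ht⟩ : ∃ t, Fintype.card V = r + 1 + t := ⟨_, (Nat.add_sub_cancel' hr).symm⟩
    have e : r + 1 + t - 1 - r = t := by omega
    rw [ht, e] at heq
    rw [ht] at key hm
    generalize hS : ∑ v, deg D v * deg D v = S at key heq
    generalize hH : ∑ v, deg (missingGraph D A) v * deg (missingGraph D A) v = HH at key
    generalize hM' : D.edgeFinset.card = M at key heq hm
    obtain ⟨r', rfl⟩ : ∃ r', r = r' + 3 := ⟨r - 3, by omega⟩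
    have e2 : r' + 3 - 2 = r' + 1 := by omega
    rw [e2] at heq ⊢
    have hmk : a * (r' + 3 + 1 + t - a) = M + (r' + 3) := hm.symm
    rw [hmk] at key
    nlinarith [key, heq]
  have hr3' : 3 ≤ (missingGraph D A).edgeFinset.card := by rw [hM]; exact hr3
  rw [← hM] at hHeq
  rcases broom_or_c4_of_eq (missingGraph D A) hfree hr3' hns' hHeq with h | ⟨h4, hc⟩
  · exact Or.inl h
  · right
    rw [hM] at h4
    exact ⟨h4, hc⟩

/-- **THE SECOND-BEST LOCUS OF THE ROW `a = 3` AT `r ≥ 3`:** for `3 ≤ r`, `r + 7 ≤ k`, a `K₄⁻`-free graph on `Fin k` with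
`3 (k − 3) − r` edges at the second-best value `m k − r (k − 1 − r) − secondGapThree k r` is `3`-bipartite with a
missing graph that is a broom or (`r = 4`) a `4`-cycle. -/
theorem three_row_second_best_locus (k r : ℕ) (hr3 : 3 ≤ r) (hk : r + 7 ≤ k) (D : SimpleGraph (Fin k))
    [DecidableRel D.Adj] (hK : K4mFree D) (hm : D.edgeFinset.card + r = 3 * (k - 3))
    (heq : ∑ v, deg D v * deg D v + r * (k - 1 - r) + secondGapThree k r = D.edgeFinset.card * k) :
    ∃ A : Finset (Fin k), A.card = 3 ∧ BipSub D A ∧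
      (IsBroom (missingGraph D A) ∨ (r = 4 ∧ IsC4 (missingGraph D A))) := by
  have hcard : Fintype.card (Fin k) = k := Fintype.card_fin k
  have hgap : secondGapThree k r = 2 * (r - 2) := by
    simp only [secondGapThree]
    rw [if_neg (by omega)]
    congr 1
    omega
  rw [hgap] at heq
  by_cases hbip : ∃ A : Finset (Fin k), A.card = 3 ∧ BipSub D A
  · obtain ⟨A, hAcard, hA⟩ := hbip
    refine ⟨A, hAcard, hA, ?_⟩
    have hns : ¬ ∃ v, MissingStar D A v := by
      rintro ⟨v, hv⟩
      have h := closed_form_eq_of_missingStar D A hA hv 3 r hAcard (by rw [hcard]; exact hm) (by rw [hcard]; omega)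
      rw [hcard] at h
      omega
    exact bipSub_second_best_locus D A hA 3 r hAcard (by rw [hcard]; exact hm) (by rw [hcard]; omega) hr3 hns
      (by rw [hcard]; exact heq)
  · exfalso
    have h := three_row_second_order_pos D hK r (by omega) (by rw [hcard]; exact hk) (by rw [hcard]; omega) hbip
    rw [hcard] at h
    omega

end C047

end TriangleCap

end PercRepro
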